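import Summits.RiemannHypothesis.RiemannHypothesis.Theorems.PfPersistenceBarrierCriterion
import Summits.RiemannHypothesis.RiemannHypothesis.Theorems.PfPersistenceF5TailTwins
import Summits.RiemannHypothesis.RiemannHypothesis.Theorems.SoloInformedGroundStateDecay2
import Literature.NumberTheory.LFunctions.WeilGroundEnergyProofs
import Literature.NumberTheory.LFunctions.WeilGroundEnergyParitySplit
import HarnessLib

/-!
# PF-persistence BARRIER, VI: accumulation — the zero-margin wall W2 in the continuum model, UNCONDITIONAL

Framing (page 1 of every `pub-rhpf` file): **long-odds MECHANISM SEARCH — nothing here is a claim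
about RH.**  Every RH-bearing proposition is a HYPOTHESIS of a theorem, one side of a proved `↔`, or
one branch of a proved DICHOTOMY `¬ WeilPositivity ∨ …`; negativity of a control datum is never
asserted unless PROVED.

The zero-margin wall W2 of the barrier (`PfPersistenceBarrierWalls`, `no_nhds_discriminator`): an
invariant that is ROBUST at `ζ` — it holds on a whole neighbourhood of `ζ`'s data — cannot
discriminate `ζ` from a negative class whose members ACCUMULATE at `ζ`.  So far the accumulation
input was either a limit family converging to `ζ` from the positive side (`lambdapert`, W2-Weil) or,
in the Galerkin model, TYPED observatory data (`DialReady`, GAP B-TYPED-2).  This file proves the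
accumulation UNCONDITIONALLY in the continuum model, in the `a`-UNIFORM topology (closeness of the
quadratic functionals on ALL windows at once, `ExplicitDatum.UniformlyClose`), for the observatory's
PLANTED family:

* `uniformlyClose_zetaDatum_plantedDatum` — a planted mass of weight `w` moves `Re Q` by at most
  `2|w| ‖g‖₂²` on every Weil test (Bombieri's `|(g ⋆ g̃)(t)| ≤ ‖g‖₂²`): planted data with small
  weight are UNIFORMLY close to `ζ`, at every position `y`.
* `re_plantedDatum_quadratic_twin_le` — THEOREM F5-A with the planted mass in place of the dial:
  if `ζ` is Weil-positive on the window `c + b` and `g₁ ⊆ [-b, b]` has Rayleigh quotient `≤ δ`,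
  the twin `τ_{-c} g₁ - σ τ_c g₁` has `Re Q_planted(w, 2c) ≤ (4δ + 2wσ) ‖g₁‖₂²`.
* `exists_isWeilTest_rayleigh_lt` — RH-free: Rayleigh quotients `< δ` exist on large windows
  (the tree's upper law `weilGroundEnergy_exp_exp_decay`, `ε(a) ≤ C exp(-c e^{2a})`).
* `not_weilPositivity_or_planted_negativesAccumulateNe` — **the dichotomy**: either `ζ` fails Weil
  positivity, or for every `ε > 0` some planted datum `≠ ζ`, uniformly `ε`-close to `ζ`, FAILS
  window positivity.  In both branches the conclusion of W2 follows:
* `no_uniformlyRobust_discriminator_semantic` — **no predicate uniformly robust at `ζ`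
  discriminates `ζ` from the non-positive data (UNCONDITIONAL)**; against a declared negative class
  containing the non-positive planted data, a uniformly robust discriminator would REFUTE RH
  (`not_riemannHypothesis_of_uniformlyRobust_planted_discriminator`); margins of uniformly
  Lipschitz functionals are `≤ 0` (`no_uniformlyLipschitz_margin`).

This closes leaf B-W2 of `CLOSED-CLASSES.md` without the DATA input R3(b): the negativity of the
accumulating controls is a theorem (in dichotomy with `¬ WeilPositivity`, which kills every
criterion anyway).  What it does NOT say: nothing about invariants that are continuous only
window-by-window with an `a`-dependent modulus (GAP class G1), nor about the Galerkin dial leaf at a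
FIXED prime (`DialReady`, still DATA).

References: E. Bombieri, Rend. Lincei (9) 11 (2000) 183–233, §4 Lemma 2 and Thm 2
(bib `Bombieri2000Weil`); the F5-A twin construction `PfPersistenceF5TailTwins` (tree).
-/

set_option linter.dupNamespace false

noncomputable section

open MeasureTheory Set Filter Complex
open scoped Real Topology ComplexConjugate

namespace Summit.RiemannHypothesis.RiemannHypothesis.Theorems.PfPersistenceBarrier

open Literature.NumberTheory.LFunctions
open ExplicitDatum
open Summit.RiemannHypothesis.RiemannHypothesis.Theorems.PfPersistenceF5TailTwins

/-! ### Uniform closeness, uniform robustness, accumulation (continuum model) -/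

/-- UNIFORM closeness of two explicit data: the real parts of their quadratic functionals differ by
at most `ε ‖g‖₂²` on EVERY Weil test `g` — all windows at once (the continuum version of the
Galerkin `UniformlyClose` of `PfPersistenceAdmissibleClass`). [folklore] -/
def ExplicitDatum.UniformlyClose (ε : ℝ) (F G : ExplicitDatum) : Prop :=
  ∀ g : ℝ → ℂ, IsWeilTest g → |(F.quadratic g).re - (G.quadratic g).re| ≤ ε * ∫ x, ‖g x‖ ^ 2

/-- A predicate is UNIFORMLY ROBUST at `F₀`: it holds on a whole `UniformlyClose`-ball about `F₀`
(an invariant with an `a`-UNIFORM modulus of continuity, holding at `F₀` with a margin). [folklore] -/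
def ExplicitDatum.UniformlyRobustAt (P : ExplicitDatum → Prop) (F₀ : ExplicitDatum) : Prop :=
  ∃ ε : ℝ, 0 < ε ∧ ∀ G : ExplicitDatum, UniformlyClose ε F₀ G → P G

/-- NEGATIVES OF `D` OTHER THAN `F₀` ACCUMULATE AT `F₀`, uniformly: for every `ε > 0` some member of
`D`, different from `F₀` and FAILING window positivity, is uniformly `ε`-close to `F₀`. [folklore] -/
def ExplicitDatum.NegativesAccumulateNe (D : Set ExplicitDatum) (F₀ : ExplicitDatum) : Prop :=
  ∀ ε : ℝ, 0 < ε → ∃ G ∈ D, G ≠ F₀ ∧ ¬ G.Positivity ∧ UniformlyClose ε F₀ G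

/-- A real functional is UNIFORMLY LIPSCHITZ at `F₀` with constant `L`. [folklore] -/
def ExplicitDatum.UniformlyLipschitzAt (f : ExplicitDatum → ℝ) (F₀ : ExplicitDatum) (L : ℝ) : Prop :=
  ∀ ε : ℝ, 0 ≤ ε → ∀ G : ExplicitDatum, UniformlyClose ε F₀ G → |f F₀ - f G| ≤ L * ε

/-- The PLANTED family of the observatory (real weight `w`, position `y`). [folklore] -/
def plantedFamily : Set ExplicitDatum :=
  {G | ∃ w y : ℝ, G = plantedDatum (w : ℂ) y}

/-- Uniform closeness is monotone in `ε`. [folklore] -/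
theorem ExplicitDatum.UniformlyClose.mono {ε ε' : ℝ} {F G : ExplicitDatum}
    (h : UniformlyClose ε F G) (hε : ε ≤ ε') : UniformlyClose ε' F G :=
  fun g hg ↦ (h g hg).trans (mul_le_mul_of_nonneg_right hε (integral_nonneg fun _ ↦ by positivity))

/-- A uniformly robust predicate holds at some non-positive `G ≠ F₀` of any family whose negatives
accumulate at `F₀`. [folklore] -/
theorem ExplicitDatum.UniformlyRobustAt.exists_not_positivity {P : ExplicitDatum → Prop}
    {D : Set ExplicitDatum} {F₀ : ExplicitDatum} (hP : UniformlyRobustAt P F₀)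
    (hacc : NegativesAccumulateNe D F₀) : ∃ G ∈ D, G ≠ F₀ ∧ ¬ G.Positivity ∧ P G := by
  obtain ⟨ε, hε, hball⟩ := hP
  obtain ⟨G, hGD, hne, hneg, hclose⟩ := hacc ε hε
  exact ⟨G, hGD, hne, hneg, hball G hclose⟩

/-- W2, abstract form in this topology: accumulation of the negatives of `D` at `F₀` kills every
uniformly robust discriminator against any class containing the non-positive members of `D`. [folklore] -/
theorem no_uniformlyRobust_discriminator_of_accumulate {P : ExplicitDatum → Prop}
    {D Neg : Set ExplicitDatum} {F₀ : ExplicitDatum} (hP : UniformlyRobustAt P F₀)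
    (hacc : NegativesAccumulateNe D F₀) (hNeg : ∀ G ∈ D, ¬ G.Positivity → G ∈ Neg) :
    ¬ Discriminates P F₀ Neg := by
  intro hdisc
  obtain ⟨G, hGD, -, hneg, hPG⟩ := hP.exists_not_positivity hacc
  exact hdisc.not_of_mem (hNeg G hGD hneg) hPG

/-! ### Planted data are uniformly close to `ζ` -/

/-- **A planted mass of weight `w` moves `Re Q` by at most `2|w| ‖g‖₂²` on every Weil test**
(`Q_planted(g) = Q_ζ(g) − w (A_g(y) + A_g(−y))`, `|A_g(t)| ≤ ‖g‖₂²`, Bombieri §4 Lemma 2): planted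
data are UNIFORMLY `2|w|`-close to `ζ`, whatever the position `y`. [cite: Bombieri2000Weil, §4 Lemma 2] -/
theorem uniformlyClose_zetaDatum_plantedDatum (w y : ℝ) :
    UniformlyClose (2 * |w|) zetaDatum (plantedDatum (w : ℂ) y) := by
  intro g hg
  rw [zetaDatum_quadratic, plantedDatum_quadratic (w : ℂ) y hg, Complex.sub_re, Complex.re_ofReal_mul]
  set A : ℝ := (weilConv g (weilReflect g) y + weilConv g (weilReflect g) (-y)).re with hA_def
  have hA : |A| ≤ 2 * ∫ x, ‖g x‖ ^ 2 :=
    calc |A| ≤ ‖weilConv g (weilReflect g) y + weilConv g (weilReflect g) (-y)‖ :=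
          Complex.abs_re_le_norm _
      _ ≤ ‖weilConv g (weilReflect g) y‖ + ‖weilConv g (weilReflect g) (-y)‖ := norm_add_le _ _
      _ ≤ (∫ x, ‖g x‖ ^ 2) + ∫ x, ‖g x‖ ^ 2 :=
          add_le_add (norm_weilConv_weilReflect_le hg y) (norm_weilConv_weilReflect_le hg (-y))
      _ = 2 * ∫ x, ‖g x‖ ^ 2 := by ring
  have e : (weilQuadratic g).re - ((weilQuadratic g).re - w * A) = w * A := by ring
  rw [e, abs_mul]
  calc |w| * |A| ≤ |w| * (2 * ∫ x, ‖g x‖ ^ 2) := mul_le_mul_of_nonneg_left hA (abs_nonneg w)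
    _ = 2 * |w| * ∫ x, ‖g x‖ ^ 2 := by ring

/-- A planted datum with weight `w ≠ 0` is not `ζ` (its slot `0` carries the mass). [folklore] -/
theorem plantedDatum_ne_zetaDatum {w : ℝ} (hw : w ≠ 0) (y : ℝ) : plantedDatum (w : ℂ) y ≠ zetaDatum := by
  intro h
  have h0 : (plantedDatum (w : ℂ) y).wt 0 = zetaDatum.wt 0 := by rw [h]
  rw [zetaDatum_wt_zero] at h0
  simp [plantedDatum] at h0
  exact hw h0

/-! ### THEOREM F5-A for the planted mass: the twin test -/

/-- **Planted Rayleigh bound (the F5-A twin with the planted mass in place of the dial).**  If `ζ`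
is Weil-positive on the window `c + b`, `0 < b < c`, and `g₁ ⊆ [-b, b]` has `Re Q_ζ(g₁) ≤ δ ‖g₁‖₂²`,
then for `σ² ≤ 1` the twin `g = τ_{-c} g₁ − σ τ_c g₁` satisfies
`Re Q_{planted(w, 2c)}(g) ≤ (4δ + 2wσ) ‖g₁‖₂²`: the parallelogram law and positivity of the mirror
twin give `Re Q_ζ(g) ≤ 4δ‖g₁‖₂²`, and the planted mass at `± 2c` sees exactly the cross
autocorrelation `A_g(± 2c) = −σ ‖g₁‖₂²`. [folklore] -/
theorem re_plantedDatum_quadratic_twin_le {b c δ : ℝ} (hb : 0 < b) (hbc : b < c)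
    (hW : WeilPositivityOn (c + b)) {g₁ : ℝ → ℂ} (hg : IsWeilTest g₁)
    (hs : tsupport g₁ ⊆ Icc (-b) b) (hq : (weilQuadratic g₁).re ≤ δ * ∫ x, ‖g₁ x‖ ^ 2)
    (w : ℝ) {σ : ℝ} (hσ : σ ^ 2 ≤ 1) :
    ((plantedDatum (w : ℂ) (2 * c)).quadratic (twin c σ g₁)).re ≤
      (4 * δ + 2 * w * σ) * ∫ x, ‖g₁ x‖ ^ 2 := by
  obtain ⟨N, hN_def⟩ : ∃ N : ℝ, N = ∫ x, ‖g₁ x‖ ^ 2 := ⟨_, rfl⟩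
  rw [← hN_def] at hq ⊢
  have hc0 : 0 < c := hb.trans hbc
  -- the two translates and the positivity inputs (as in `tailDialRayleighBound`)
  set u : ℝ → ℂ := PfPersistenceF5TailTwins.translate (-c) g₁ with hu_def
  set v : ℝ → ℂ := PfPersistenceF5TailTwins.translate c g₁ with hv_def
  have hu : IsWeilTest u := PfPersistenceF5TailTwins.isWeilTest_translate hg _
  have hv : IsWeilTest v := PfPersistenceF5TailTwins.isWeilTest_translate hg _
  have hus : tsupport u ⊆ Icc (-(c + b)) (c + b) :=
    (PfPersistenceF5TailTwins.tsupport_translate_subset hs (-c)).trans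
      (Icc_subset_Icc (by linarith) (by linarith))
  have hvs : tsupport v ⊆ Icc (-(c + b)) (c + b) :=
    (PfPersistenceF5TailTwins.tsupport_translate_subset hs c).trans
      (Icc_subset_Icc (by linarith) (by linarith))
  have hQu : (weilQuadratic u).re = (weilQuadratic g₁).re := by
    rw [hu_def, PfPersistenceF5TailTwins.weilQuadratic_translate]
  have hQv : (weilQuadratic v).re = (weilQuadratic g₁).re := by
    rw [hv_def, PfPersistenceF5TailTwins.weilQuadratic_translate]
  have hQ1 : 0 ≤ (weilQuadratic g₁).re :=
    hW g₁ hg (hs.trans (Icc_subset_Icc (by linarith) (by linarith)))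
  have hplus : 0 ≤ (weilQuadratic (u + fun x ↦ ((σ : ℝ) : ℂ) * v x)).re :=
    hW _ (hu.add (hv.const_mul _)) (tsupport_add_mul_subset isClosed_Icc hus hvs _)
  -- parallelogram: Re Q(u - σ v) ≤ 2 Re Q(u) + 2σ² Re Q(v) ≤ 4δN
  have hQg : (weilQuadratic (twin c σ g₁)).re ≤ 4 * (δ * N) := by
    rw [twin_eq_add c σ g₁, ConnesVanSuijlekom.re_weilQuadratic_add_real_mul hu hv (-σ)]
    rw [ConnesVanSuijlekom.re_weilQuadratic_add_real_mul hu hv σ] at hplus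
    rw [hQu, hQv] at hplus ⊢
    have h1 : σ ^ 2 * (weilQuadratic g₁).re ≤ (weilQuadratic g₁).re :=
      mul_le_of_le_one_left hQ1 hσ
    nlinarith [hσ, hQ1, hq, sq_nonneg σ]
  -- the planted mass at ± 2c sees the cross autocorrelation -σN
  have hA1 : weilConv (twin c σ g₁) (weilReflect (twin c σ g₁)) (2 * c) = -(σ : ℂ) * (N : ℂ) := by
    rw [hN_def]; exact weilConv_weilReflect_twin_two_mul hs hb hbc σ
  have hA2 : weilConv (twin c σ g₁) (weilReflect (twin c σ g₁)) (-(2 * c)) = -(σ : ℂ) * (N : ℂ) := by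
    rw [hN_def]; exact weilConv_weilReflect_twin_neg_two_mul hs hb hbc σ
  rw [plantedDatum_quadratic (w : ℂ) (2 * c) (isWeilTest_twin hg c σ), hA1, hA2, Complex.sub_re]
  have e : ((w : ℂ) * (-(σ : ℂ) * (N : ℂ) + -(σ : ℂ) * (N : ℂ))).re = -(2 * w * σ * N) := by
    have : (w : ℂ) * (-(σ : ℂ) * (N : ℂ) + -(σ : ℂ) * (N : ℂ)) = ((-(2 * w * σ * N) : ℝ) : ℂ) := by
      push_cast; ring
    rw [this, Complex.ofReal_re]
  rw [e]
  nlinarith [hQg]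

/-- **Hence a planted datum is NOT positive** once `2δ < |w|` for some admissible `(b, c, g₁)`: with
`σ = −sign w` the bound is `(4δ − 2|w|) ‖g₁‖₂² < 0`. [folklore] -/
theorem plantedDatum_not_positivity_of_rayleigh {b c δ w : ℝ} (hb : 0 < b) (hbc : b < c)
    (hW : WeilPositivityOn (c + b)) {g₁ : ℝ → ℂ} (hg : IsWeilTest g₁)
    (hs : tsupport g₁ ⊆ Icc (-b) b) (hq : (weilQuadratic g₁).re ≤ δ * ∫ x, ‖g₁ x‖ ^ 2)
    (hpos : 0 < ∫ x, ‖g₁ x‖ ^ 2) (hw : 2 * δ < |w|) :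
    ¬ (plantedDatum (w : ℂ) (2 * c)).Positivity := by
  intro hP
  rcases le_or_gt 0 w with hw0 | hw0
  · -- w ≥ 0: the symmetric twin σ = -1
    have hle := re_plantedDatum_quadratic_twin_le hb hbc hW hg hs hq w (σ := -1) (by norm_num)
    have h0 := hP _ (isWeilTest_twin hg c (-1))
    rw [abs_of_nonneg hw0] at hw
    nlinarith
  · -- w < 0: the antisymmetric twin σ = 1
    have hle := re_plantedDatum_quadratic_twin_le hb hbc hW hg hs hq w (σ := 1) (by norm_num)
    have h0 := hP _ (isWeilTest_twin hg c 1)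
    rw [abs_of_neg hw0] at hw
    nlinarith

/-! ### RH-free: small Rayleigh quotients on large windows -/

/-- **RH-free input: Rayleigh quotients `< δ` exist.**  For every `δ > 0` some window `b ≥ 1` carries
an `L²`-normalised Weil test `g₁ ⊆ [-b, b]` with `Re Q_ζ(g₁) < δ` — the tree's unconditional upper
law `ε(b) ≤ C exp(−c e^{2b})` (`weilGroundEnergy_exp_exp_decay`) and `ε(b) = inf` of the sphere
values. [folklore] -/
theorem exists_isWeilTest_rayleigh_lt {δ : ℝ} (hδ : 0 < δ) :
    ∃ b : ℝ, 1 ≤ b ∧ ∃ g₁ : ℝ → ℂ, IsWeilTest g₁ ∧ tsupport g₁ ⊆ Icc (-b) b ∧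
      ∫ x, ‖g₁ x‖ ^ 2 = 1 ∧ (weilQuadratic g₁).re < δ := by
  obtain ⟨c, hc, C, hC⟩ := weilGroundEnergy_exp_exp_decay
  have h1 : Tendsto (fun b : ℝ ↦ Real.exp (2 * b)) atTop atTop :=
    Real.tendsto_exp_atTop.comp (tendsto_id.const_mul_atTop two_pos)
  have h2 : Tendsto (fun b : ℝ ↦ C * Real.exp (-(c * Real.exp (2 * b)))) atTop (𝓝 (C * 0)) :=
    (Real.tendsto_exp_atBot.comp (tendsto_neg_atTop_atBot.comp (h1.const_mul_atTop hc))).const_mul C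
  rw [mul_zero] at h2
  obtain ⟨b, hbδ, hb1⟩ := ((h2.eventually (gt_mem_nhds hδ)).and (eventually_ge_atTop 1)).exists
  have hlt : sInf (weilWindowSphereValues (fun _ ↦ True) b) < δ := by
    rw [← weilGroundEnergy_eq_sInf]
    have h := hC b hb1
    rw [neg_mul] at h
    exact h.trans_lt hbδ
  obtain ⟨x, ⟨g, hg, hs, -, hn, rfl⟩, hx⟩ :=
    exists_lt_of_csInf_lt (weilWindowSphereValues_top_nonempty (by linarith)) hlt
  exact ⟨b, hb1, g, hg, hs, hn, hx⟩

/-! ### The dichotomy and the wall -/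

/-- **ACCUMULATION DICHOTOMY (RH-free).**  Either `ζ` fails Weil positivity, or the negatives of the
planted family OTHER THAN `ζ` accumulate at `ζ` UNIFORMLY: for every `ε > 0` the planted datum of
weight `ε/2` at a far position `2(b + 1)` is uniformly `ε`-close to `ζ` on all windows, differs from
`ζ`, and FAILS window positivity (twin test about a window of Rayleigh quotient `< ε/8`). [folklore] -/
theorem not_weilPositivity_or_planted_negativesAccumulateNe :
    ¬ WeilPositivity ∨ NegativesAccumulateNe plantedFamily zetaDatum := by
  by_cases hW : WeilPositivity
  · refine Or.inr fun ε hε ↦ ?_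
    obtain ⟨b, hb1, g₁, hg, hs, hn, hq⟩ := exists_isWeilTest_rayleigh_lt (by positivity : 0 < ε / 8)
    have hb : 0 < b := by linarith
    refine ⟨plantedDatum ((ε / 2 : ℝ) : ℂ) (2 * (b + 1)), ⟨ε / 2, 2 * (b + 1), rfl⟩,
      plantedDatum_ne_zetaDatum (by positivity) _, ?_, ?_⟩
    · exact plantedDatum_not_positivity_of_rayleigh (δ := ε / 8) hb (by linarith) (fun g hg' _ ↦ hW g hg')
        hg hs (by rw [hn, mul_one]; exact hq.le) (by rw [hn]; exact one_pos)
        (by rw [abs_of_pos (by positivity)]; linarith)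
    · exact (uniformlyClose_zetaDatum_plantedDatum (ε / 2) _).mono
        (by rw [abs_of_pos (by positivity)]; linarith)
  · exact Or.inl hW

/-- Under RH (hence Weil positivity) the second branch holds: planted negatives `≠ ζ` accumulate at
`ζ` uniformly. [cite: Bombieri2000Weil, Thm 2 (p. 193)] -/
theorem planted_negativesAccumulateNe_of_riemannHypothesis (hRH : RiemannHypothesis) :
    NegativesAccumulateNe plantedFamily zetaDatum :=
  not_weilPositivity_or_planted_negativesAccumulateNe.resolve_left
    (not_not.2 (weil_criterion_holds.1 hRH))

/-- **THE ZERO-MARGIN WALL W2, continuum model, UNCONDITIONAL.**  No predicate that is uniformly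
robust at `ζ` (true on a whole `UniformlyClose`-ball about `ζ`'s data) discriminates `ζ` from the
data failing window positivity: in the first branch of the dichotomy `ζ` itself is in the negative
class, in the second a non-positive planted datum lies in the ball. [folklore] -/
theorem no_uniformlyRobust_discriminator_semantic {P : ExplicitDatum → Prop}
    (hP : UniformlyRobustAt P zetaDatum) : ¬ Discriminates P zetaDatum {F | ¬ F.Positivity} := by
  intro hdisc
  rcases not_weilPositivity_or_planted_negativesAccumulateNe with hW | hacc
  · exact hdisc.not_of_mem (show zetaDatum ∈ {F : ExplicitDatum | ¬ F.Positivity} from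
      fun h ↦ hW (zetaDatum_positivity_iff.1 h)) hdisc.self
  · exact no_uniformlyRobust_discriminator_of_accumulate hP hacc (fun G _ hG ↦ hG) hdisc

/-- … nor from any negative class containing the non-positive data. [folklore] -/
theorem no_uniformlyRobust_discriminator {P : ExplicitDatum → Prop}
    (hP : UniformlyRobustAt P zetaDatum) {Neg : Set ExplicitDatum}
    (hNeg : ∀ F : ExplicitDatum, ¬ F.Positivity → F ∈ Neg) : ¬ Discriminates P zetaDatum Neg :=
  fun hdisc ↦ no_uniformlyRobust_discriminator_semantic hP (hdisc.mono fun F hF ↦ hNeg F hF)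

/-- **The wall in one line.** The class of predicates uniformly robust at `ζ` contains no
PF-persistence criterion (compare `no_windowLocal_criterion`, the twin wall W1). [folklore] -/
theorem no_uniformlyRobust_criterion :
    ¬ ∃ P : ExplicitDatum → Prop,
      UniformlyRobustAt P zetaDatum ∧ Discriminates P zetaDatum {F | ¬ F.Positivity} :=
  fun ⟨_, hP, hdisc⟩ ↦ no_uniformlyRobust_discriminator_semantic hP hdisc

/-- **Against the DECLARED planted negatives, a uniformly robust discriminator REFUTES RH.**  If `Neg`
contains every non-positive planted datum and some predicate uniformly robust at `ζ` discriminates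
`ζ` from `Neg`, then `ζ` is not Weil-positive, i.e. RH fails (`weil_criterion_holds`).  Exhibiting
such an invariant is therefore exactly as hard as disproving RH. [cite: Bombieri2000Weil, Thm 2 (p. 193)] -/
theorem not_riemannHypothesis_of_uniformlyRobust_planted_discriminator {P : ExplicitDatum → Prop}
    (hP : UniformlyRobustAt P zetaDatum) {Neg : Set ExplicitDatum}
    (hNeg : ∀ G ∈ plantedFamily, ¬ G.Positivity → G ∈ Neg) (hdisc : Discriminates P zetaDatum Neg) :
    ¬ RiemannHypothesis := by
  intro hRH
  exact no_uniformlyRobust_discriminator_of_accumulate hP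
    (planted_negativesAccumulateNe_of_riemannHypothesis hRH) hNeg hdisc

/-- **Margins vanish (W2, quantitative).**  A real functional uniformly Lipschitz at `ζ` has NO
positive margin over the non-positive planted data — unless `ζ` fails Weil positivity: for every
`m > 0` some non-positive planted `G ≠ ζ` has `f G > f ζ − m`. [folklore] -/
theorem no_uniformlyLipschitz_margin {f : ExplicitDatum → ℝ} {L : ℝ}
    (hf : UniformlyLipschitzAt f zetaDatum L) :
    ¬ WeilPositivity ∨ ∀ m : ℝ, 0 < m →
      ∃ G ∈ plantedFamily, G ≠ zetaDatum ∧ ¬ G.Positivity ∧ f zetaDatum - m < f G := by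
  refine not_weilPositivity_or_planted_negativesAccumulateNe.imp_right fun hacc m hm ↦ ?_
  have hL1 : 0 < |L| + 1 := by positivity
  obtain ⟨G, hGD, hne, hneg, hclose⟩ := hacc (m / (2 * (|L| + 1))) (by positivity)
  refine ⟨G, hGD, hne, hneg, ?_⟩
  have h := hf _ (by positivity) G hclose
  have hL : L * (m / (2 * (|L| + 1))) ≤ |L| * (m / (2 * (|L| + 1))) :=
    mul_le_mul_of_nonneg_right (le_abs_self L) (by positivity)
  have hlt : |L| * (m / (2 * (|L| + 1))) < m := by
    rw [← mul_div_assoc, div_lt_iff₀ (by positivity)]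
    nlinarith [abs_nonneg L]
  have := (abs_sub_lt_iff.1 (lt_of_le_of_lt (h.trans hL) hlt)).1
  linarith

end Summit.RiemannHypothesis.RiemannHypothesis.Theorems.PfPersistenceBarrier
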